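import Summits.QuantumFields.BalabanUV.Beta.D1BFx.PackedCoframePairTerms
import Summits.QuantumFields.BalabanUV.Beta.D1BFx.PackedCoframePairLoc
import Summits.QuantumFields.BalabanUV.Beta.D1BFx.PackedSortedBridges

/-!
# BetaPertH road «BF-x» — «COFRAME-PACK-2» P3c: the twisted mixed co-frame weight jet at response-packed jets IS ONE ARRAY

STATUS: [folklore] torus bookkeeping of the road's (A1)-PACKED identity (BINDER row D1, slot (K), chain step (I)); NOT an estimate of Bałaban's,
NOT a discharge of any root-level binder.  Provenance: reconstruction; the manuscript(s) under audit are NOT citable.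

WHAT.  On the torus `Site 4 ((m+1)·p)`, over any basis `N` of `ker Ŝ`, for weight families `w` (centre `P`), `w′` (centre `P′`) decaying at a rate
`0 < δ ≤ dB (m+1) a∕8` and their torus responses `r`, `r′` (the road's letters `hrₛ hrₜ`):
* §1 [folklore] the four computed words of P2's expansion as arrays: `W9_eq_hat` (`M̂₀ᵀĈM̂₂ = (arr k9)^`), `W5_eq_hat` (`−M̂ₛᵀĈM̂ₜ = (arr k5)^`),
  `W7_eq_hat` (`M̂₀ᵀĈₛM̂ₜ = (arr (k7 w w′))^`, hence W8 with the weights exchanged), `W4_eq_hat` (`M̂₀ᵀĈ₂M̂₀ = (arr k4)^`);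
* §2 [folklore] the transposed words `W1_eq_hat`, `W2_eq_hat`, `W3_eq_hat`, `W6_eq_hat` (`transpose_hat_arr`; `Ljet`, `Cjet₁` antisymmetric);
* §3 [folklore] **`two_smul_sum_sum_twgtMix_eq_hat : 2 • Σ_{kl} (r k·r′ l) • twgtMix s (e₁ k) (e₁ l) N = (arr s (cofPair s (m+1) a w w′))^`** and, at the road's
  `N̂` with TB4-W's packed jets, **`tgramMix_packed_eq_hat_submatrix`** ∕ **`tgramMix_packed_eq_blocksHat`** — the co-frame half of PART 4's `hJN″`.
Unit `b2b-balaban-beta-d1-formalise-leaf-03` (gen 23); road owner `b2b-balaban-beta-d1-p2` (W-d1p2-g18-4∕-5, journal l.40583).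
-/

noncomputable section

namespace Summit.QuantumFields.BalabanUV.Beta.D1BFx.PackedCoframePair

open Matrix
open scoped BigOperators
open Literature.Probability.LatticeModels (TorusSite)
open Literature.MathematicalPhysics.QuantumFieldTheory.Balaban1983to89
open Literature.MathematicalPhysics.QuantumFieldTheory.Balaban1983to89.Beta
open B12Sec2to5 (l1 l1_nonneg)
open ExpKernelCalculus (MKer BiLoc Decays comp Zl)
open AffineAveraging (box)
open Summit.QuantumFields.BalabanUV.Beta.TameKernelCalculus (Loc trK)
open Summit.QuantumFields.BalabanUV.Beta.D1BFx.SortedReblocking (torusBlockEquiv)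
open Summit.QuantumFields.BalabanUV.Beta.D1BFx.SortedEmbedding (e₁)
open Summit.QuantumFields.BalabanUV.Beta.D1BFx.SortedKernels (blocksHat)
open Summit.QuantumFields.BalabanUV.Beta.D1BFx.SortedPack (sortK)
open Summit.QuantumFields.BalabanUV.Beta.D1BFx.PeriodicArrays (arr toF)
open Summit.QuantumFields.BalabanUV.Beta.D1BFx.FibredPeriodisation (periodiseF)
open Summit.QuantumFields.BalabanUV.Beta.D1BFx.TorusCombKKT (I J CombRows)
open Summit.QuantumFields.BalabanUV.Beta.D1BFx.PeriodisedProjector (Lhat Shat)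
open Summit.QuantumFields.BalabanUV.Beta.D1BFx.TorusHodgeWeight (Dhat)
open Summit.QuantumFields.BalabanUV.Beta.D1BFx.TorusGaugeWeight (Lhat_transpose)
open Summit.QuantumFields.BalabanUV.Beta.D1BFx.TorusGaugeBasisMatrix (Nhat)
open Summit.QuantumFields.BalabanUV.Beta.D1BFx.TorusGaugeBasisKernel (Nhat_range Nhat_injective)
open Summit.QuantumFields.BalabanUV.Beta.D1BFx.TorusCoframeJets (Djet Ljet Ljet₂ Mjet₀ Mjet₁ Mjet₁₁ Tjet₀ Tjet₁ Tjet₁₁ Ajet₀ Ajet₁ Ajet₁₁ transpose_Ljet)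
open Summit.QuantumFields.BalabanUV.Beta.D1BFx.TorusWeightJetsCombFree (Lsq₁ Lsq₁₁ Chat Cjet₁ Cjet₁₁)
open Summit.QuantumFields.BalabanUV.Beta.D1BFx.TorusWeightJetsTwisted (twgtMix tgramMix_Tjet transpose_Chat transpose_Cjet₁)
open Summit.QuantumFields.BalabanUV.Beta.D1BFx.GramWeightColourLift (tgramMix)
open Summit.QuantumFields.BalabanUV.Beta.D1BFx.PackedSlotMultilinear (tgramMix_packed)
open Summit.QuantumFields.BalabanUV.Beta.D1BFx.PackedTowerSlots (submatrix_sum_sum_smul)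
open Summit.QuantumFields.BalabanUV.Beta.D1BFx.RJetProjector (Rgt)
open Summit.QuantumFields.BalabanUV.Beta.D1BFx.RJetAssembly (dSw)
open Summit.QuantumFields.BalabanUV.Beta.D1BFx.KGhostLeg (Cgh)
open Summit.QuantumFields.BalabanUV.Beta.D1BFx.TorusGhostWordArrays (lapU)
open Summit.QuantumFields.BalabanUV.Beta.D1BFx.TorusBondArrays (dB dB_pos hat_arr_smul)
open Summit.QuantumFields.BalabanUV.Beta.D1BFx.TorusMixedLetters (hat_arr_add_loc hat_arr_sub_loc transpose_hat_arr)
open Summit.QuantumFields.BalabanUV.Beta.D1BFx.PackedPinnedLetters (jetRw jetCw jetRCw)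
open Summit.QuantumFields.BalabanUV.Beta.D1BFx.PackedSortedBridges (embFF blocksHat_sortK_arr_embFF)
open Summit.QuantumFields.BalabanUV.Beta.D1BFx.PackedCoframePairWords (sum_smul_Mjet₁ sum_smul_Cjet₁ sum_sum_smul_Mjet₁₁ sum_sum_smul_Cjet₁₁ sum_sum_smul_twgtMix)
open Summit.QuantumFields.BalabanUV.Beta.D1BFx.PackedCoframeSiteWords (perW gW qW d2W l2W biLoc_LC_gW biLoc_gW_CL biLoc_LC_d2W biLoc_LC_qW_CL
  biLoc_LC_qW_Cgh_arr_gW biLoc_gW_Cgh_arr_gW biLoc_LC_l2W_CL biLoc_LC_qW_Cgh_arr_qW_CL)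
open Summit.QuantumFields.BalabanUV.Beta.D1BFx.PackedCoframePairTerms (T9a T9b T9d T5a T5b T5c T5d T7a T7b T4a T4b)
open Summit.QuantumFields.BalabanUV.Beta.D1BFx.PackedCoframePairLoc (k9 k5 k7 k4 cofPair ULoc uloc_loc uloc_dSw uloc_jetCw_arr uloc_jetRw_arr uloc_jetCw_mul_perW_Rgt
  uloc_jetRCw_perW_Rgt const_family uloc_k9 uloc_k5 uloc_k7 uloc_k4 loc_cofPair)

variable (m : ℕ) {a : ℝ} (p : ℕ) [NeZero p] {ρ : Type*} [Fintype ρ] [DecidableEq ρ] {N : Matrix (Site 4 ((m + 1) * p)) ρ ℝ}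
  {w w' : Fin 4 → (Fin 4 → ℤ) → ℝ} {C C' δ : ℝ} {P P' : Fin 4 → ℤ} {r r' : I 3 (m + 1) p → ℝ}
  (ha : 0 < a) (hN : ∀ lam : Site 4 ((m + 1) * p) → ℝ, Shat m ((m + 1) * p) *ᵥ lam = 0 ↔ ∃ c : ρ → ℝ, lam = N *ᵥ c)
  (hNinj : Function.Injective N.mulVec)
  (hw : ∀ κ u, |w κ u| ≤ C * Real.exp (-δ * l1 (u - P))) (hw' : ∀ κ u, |w' κ u| ≤ C' * Real.exp (-δ * l1 (u - P'))) (hδ : 0 < δ)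
  (hδB : δ ≤ dB (m + 1) a / 8)
  (hr : ∀ k, r k = ∑' t : Fin 4 → ℤ, w k.2.2 (imageShift ((m + 1) * p) (windowMap 4 ((m + 1) * p) (torusBlockEquiv (m + 1) p (k.1, k.2.1))) t))
  (hr' : ∀ k, r' k = ∑' t : Fin 4 → ℤ, w' k.2.2 (imageShift ((m + 1) * p) (windowMap 4 ((m + 1) * p) (torusBlockEquiv (m + 1) p (k.1, k.2.1))) t))

/-! ## §1 The four computed words -/

section Transposes

/-- [folklore] `(Σ_k r k • Ljet (e₁ k))ᵀ = −Σ_k r k • Ljet (e₁ k)` (`Ljet` is antisymmetric). -/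
theorem transpose_sum_smul_Ljet (r : I 3 (m + 1) p → ℝ) :
    (∑ k : I 3 (m + 1) p, r k • Ljet ((m + 1) * p) (e₁ (m + 1) p k))ᵀ = -(∑ k : I 3 (m + 1) p, r k • Ljet ((m + 1) * p) (e₁ (m + 1) p k)) := by
  rw [Matrix.transpose_sum, ← Finset.sum_neg_distrib]
  exact Finset.sum_congr rfl fun k _ => by rw [Matrix.transpose_smul, transpose_Ljet, smul_neg]

/-- [folklore] `(Σ_k r k • Cjet₁ (e₁ k) N)ᵀ = −Σ_k r k • Cjet₁ (e₁ k) N` (`Cjet₁` is antisymmetric). -/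
theorem transpose_sum_smul_Cjet₁ (r : I 3 (m + 1) p → ℝ) :
    (∑ k : I 3 (m + 1) p, r k • Cjet₁ ((m + 1) * p) (e₁ (m + 1) p k) N)ᵀ = -(∑ k : I 3 (m + 1) p, r k • Cjet₁ ((m + 1) * p) (e₁ (m + 1) p k) N) := by
  rw [Matrix.transpose_sum, ← Finset.sum_neg_distrib]
  exact Finset.sum_congr rfl fun k _ => by rw [Matrix.transpose_smul, transpose_Cjet₁, smul_neg]

end Transposes

section Words
include ha hN hNinj hw hw' hδ hδB hr hr'

/-- [folklore] **W9 = `M̂₀ᵀ·Ĉ·M̂₂` AT PACKED JETS IS `(arr k9)^`**. -/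
theorem W9_eq_hat :
    (Mjet₀ ((m + 1) * p))ᵀ * Chat ((m + 1) * p) N
        * (∑ k : I 3 (m + 1) p, ∑ l : I 3 (m + 1) p, (r k * r' l) • Mjet₁₁ ((m + 1) * p) (e₁ (m + 1) p k) (e₁ (m + 1) p l))
      = Matrix.of (periodiseF ((m + 1) * p) (toF (arr ((m + 1) * p) (k9 ((m + 1) * p) (m + 1) a w w')))) := by
  have L1 : Loc (dSw (comp (comp lapU (Cgh (m + 1) a)) (d2W w (perW ((m + 1) * p) w')))) :=
    uloc_loc (uloc_dSw (m := m) (biLoc_LC_d2W m ha hw hw' hδ hδB) (by linarith)) p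
  have L2 : Loc (jetCw w' (arr ((m + 1) * p) (comp (comp lapU (Cgh (m + 1) a)) (gW w)))) :=
    uloc_loc (uloc_jetCw_arr (m := m) hw' hδ (const_family (biLoc_LC_gW m ha hw hδ hδB)) (by linarith)) p
  have L3 : Loc (jetCw w (arr ((m + 1) * p) (comp (comp lapU (Cgh (m + 1) a)) (gW w')))) :=
    uloc_loc (uloc_jetCw_arr (m := m) hw hδ (const_family (biLoc_LC_gW m ha hw' hδ hδB)) (by linarith)) p
  have L4 : Loc (jetCw (fun κ u => w κ u * perW ((m + 1) * p) w' κ u) (Rgt (m + 1) a)) :=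
    uloc_loc (uloc_jetCw_mul_perW_Rgt (m := m) ha hw hw' hδ hδB) p
  have e : (Mjet₀ ((m + 1) * p))ᵀ * Chat ((m + 1) * p) N
        * (∑ k : I 3 (m + 1) p, ∑ l : I 3 (m + 1) p, (r k * r' l) • Mjet₁₁ ((m + 1) * p) (e₁ (m + 1) p k) (e₁ (m + 1) p l))
      = Dhat 4 ((m + 1) * p) * (Lhat ((m + 1) * p) * Chat ((m + 1) * p) N
            * (∑ k : I 3 (m + 1) p, (r k * r' k) • Ljet₂ ((m + 1) * p) (e₁ (m + 1) p k))) * (Dhat 4 ((m + 1) * p))ᵀ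
        - Dhat 4 ((m + 1) * p) * (Lhat ((m + 1) * p) * Chat ((m + 1) * p) N * (∑ k : I 3 (m + 1) p, r k • Ljet ((m + 1) * p) (e₁ (m + 1) p k)))
            * (∑ k : I 3 (m + 1) p, r' k • Djet ((m + 1) * p) (e₁ (m + 1) p k))ᵀ
        - Dhat 4 ((m + 1) * p) * (Lhat ((m + 1) * p) * Chat ((m + 1) * p) N * (∑ k : I 3 (m + 1) p, r' k • Ljet ((m + 1) * p) (e₁ (m + 1) p k)))
            * (∑ k : I 3 (m + 1) p, r k • Djet ((m + 1) * p) (e₁ (m + 1) p k))ᵀ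
        + Dhat 4 ((m + 1) * p) * (Lhat ((m + 1) * p) * Chat ((m + 1) * p) N * Lhat ((m + 1) * p))
            * (∑ k : I 3 (m + 1) p, (r k * r' k) • Djet ((m + 1) * p) (e₁ (m + 1) p k))ᵀ := by
    rw [sum_sum_smul_Mjet₁₁ _ r r' (e₁ (m + 1) p).injective, Mjet₀, Matrix.transpose_mul, Matrix.transpose_transpose, Lhat_transpose]
    simp only [Matrix.mul_add, Matrix.mul_sub, Matrix.mul_assoc]
    abel
  rw [e, T9a m p ha hN hNinj hw hw' hδ hr hr' hδB, T9b m p ha hN hNinj hw hδ hr hr' hδB,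
    T9b m p (w := w') (w' := w) ha hN hNinj hw' hδ hr' hr hδB, T9d m p ha hN hNinj hr hr', k9,
    hat_arr_add_loc _ ((L1.sub L2).sub L3) L4, hat_arr_sub_loc _ (L1.sub L2) L3, hat_arr_sub_loc _ L1 L2]

/-- [folklore] **W5 = `−M̂ₛᵀ·Ĉ·M̂ₜ` AT PACKED JETS IS `(arr k5)^`**. -/
theorem W5_eq_hat :
    -((∑ k : I 3 (m + 1) p, r k • Mjet₁ ((m + 1) * p) (e₁ (m + 1) p k))ᵀ * Chat ((m + 1) * p) N
        * (∑ k : I 3 (m + 1) p, r' k • Mjet₁ ((m + 1) * p) (e₁ (m + 1) p k)))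
      = Matrix.of (periodiseF ((m + 1) * p) (toF (arr ((m + 1) * p) (k5 ((m + 1) * p) (m + 1) a w w')))) := by
  have L1 : Loc (dSw (comp (comp (gW w) (Cgh (m + 1) a)) (arr ((m + 1) * p) (gW w')))) :=
    uloc_loc (uloc_dSw (m := m) (biLoc_gW_Cgh_arr_gW m ha hw hw' hδ hδB) (by linarith)) p
  have L2 : Loc (jetCw w' (arr ((m + 1) * p) (comp (gW w) (comp (Cgh (m + 1) a) lapU)))) :=
    uloc_loc (uloc_jetCw_arr (m := m) hw' hδ (const_family (biLoc_gW_CL m ha hw hδ hδB)) (by linarith)) p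
  have L3 : Loc (jetRw w (arr ((m + 1) * p) (comp (comp lapU (Cgh (m + 1) a)) (gW w')))) :=
    uloc_loc (uloc_jetRw_arr (m := m) hw hδ (const_family (biLoc_LC_gW m ha hw' hδ hδB)) (by linarith)) p
  have L4 : Loc (jetRCw w (perW ((m + 1) * p) w') (Rgt (m + 1) a)) := uloc_loc (uloc_jetRCw_perW_Rgt (m := m) ha hw hw' hδ hδB) p
  have e : -((∑ k : I 3 (m + 1) p, r k • Mjet₁ ((m + 1) * p) (e₁ (m + 1) p k))ᵀ * Chat ((m + 1) * p) N
        * (∑ k : I 3 (m + 1) p, r' k • Mjet₁ ((m + 1) * p) (e₁ (m + 1) p k)))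
      = Dhat 4 ((m + 1) * p) * ((∑ k : I 3 (m + 1) p, r k • Ljet ((m + 1) * p) (e₁ (m + 1) p k)) * Chat ((m + 1) * p) N
            * (∑ k : I 3 (m + 1) p, r' k • Ljet ((m + 1) * p) (e₁ (m + 1) p k))) * (Dhat 4 ((m + 1) * p))ᵀ
        - Dhat 4 ((m + 1) * p) * ((∑ k : I 3 (m + 1) p, r k • Ljet ((m + 1) * p) (e₁ (m + 1) p k)) * Chat ((m + 1) * p) N * Lhat ((m + 1) * p))
            * (∑ k : I 3 (m + 1) p, r' k • Djet ((m + 1) * p) (e₁ (m + 1) p k))ᵀ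
        + (∑ k : I 3 (m + 1) p, r k • Djet ((m + 1) * p) (e₁ (m + 1) p k))
            * (Lhat ((m + 1) * p) * Chat ((m + 1) * p) N * (∑ k : I 3 (m + 1) p, r' k • Ljet ((m + 1) * p) (e₁ (m + 1) p k)))
            * (Dhat 4 ((m + 1) * p))ᵀ
        - (∑ k : I 3 (m + 1) p, r k • Djet ((m + 1) * p) (e₁ (m + 1) p k)) * (Lhat ((m + 1) * p) * Chat ((m + 1) * p) N * Lhat ((m + 1) * p))
            * (∑ k : I 3 (m + 1) p, r' k • Djet ((m + 1) * p) (e₁ (m + 1) p k))ᵀ := by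
    rw [sum_smul_Mjet₁ _ (e₁ (m + 1) p) r, sum_smul_Mjet₁ _ (e₁ (m + 1) p) r', Matrix.transpose_sub, Matrix.transpose_mul, Matrix.transpose_mul,
      Matrix.transpose_transpose, Matrix.transpose_transpose, Lhat_transpose, transpose_sum_smul_Ljet]
    simp only [Matrix.sub_mul, Matrix.mul_sub, Matrix.neg_mul, Matrix.mul_neg, neg_sub, Matrix.mul_assoc]
    abel
  rw [e, T5a m p ha hN hNinj hw hw' hδ hr hr' hδB, T5b m p ha hN hNinj hw hδ hr hr' hδB, T5c m p ha hN hNinj hw' hδ hr hr' hδB,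
    T5d m p ha hN hNinj hr hr', k5, hat_arr_sub_loc _ ((L1.sub L2).add L3) L4, hat_arr_add_loc _ (L1.sub L2) L3, hat_arr_sub_loc _ L1 L2]

/-- [folklore] **W7 = `M̂₀ᵀ·Ĉ_w·M̂_{w′}` AT PACKED JETS IS `(arr (k7 w w′))^`** (W8 is the same with the weights exchanged). -/
theorem W7_eq_hat :
    (Mjet₀ ((m + 1) * p))ᵀ * (∑ k : I 3 (m + 1) p, r k • Cjet₁ ((m + 1) * p) (e₁ (m + 1) p k) N)
        * (∑ k : I 3 (m + 1) p, r' k • Mjet₁ ((m + 1) * p) (e₁ (m + 1) p k))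
      = Matrix.of (periodiseF ((m + 1) * p) (toF (arr ((m + 1) * p) (k7 ((m + 1) * p) (m + 1) a w w')))) := by
  have L1 : Loc (dSw (comp (comp (comp (comp lapU (Cgh (m + 1) a)) (qW w)) (Cgh (m + 1) a)) (arr ((m + 1) * p) (gW w')))) :=
    uloc_loc (uloc_dSw (m := m) (biLoc_LC_qW_Cgh_arr_gW m ha hw hw' hδ hδB) (by linarith)) p
  have L2 : Loc (jetCw w' (arr ((m + 1) * p) (comp (comp (comp lapU (Cgh (m + 1) a)) (qW w)) (comp (Cgh (m + 1) a) lapU)))) :=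
    uloc_loc (uloc_jetCw_arr (m := m) hw' hδ (const_family (biLoc_LC_qW_CL m ha hw hδ hδB)) (by linarith)) p
  have e : (Mjet₀ ((m + 1) * p))ᵀ * (∑ k : I 3 (m + 1) p, r k • Cjet₁ ((m + 1) * p) (e₁ (m + 1) p k) N)
        * (∑ k : I 3 (m + 1) p, r' k • Mjet₁ ((m + 1) * p) (e₁ (m + 1) p k))
      = -(Dhat 4 ((m + 1) * p) * (Lhat ((m + 1) * p) * Chat ((m + 1) * p) N
            * (∑ k : I 3 (m + 1) p, r k • Lsq₁ ((m + 1) * p) (e₁ (m + 1) p k)) * Chat ((m + 1) * p) N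
            * (∑ k : I 3 (m + 1) p, r' k • Ljet ((m + 1) * p) (e₁ (m + 1) p k))) * (Dhat 4 ((m + 1) * p))ᵀ)
        + Dhat 4 ((m + 1) * p) * (Lhat ((m + 1) * p) * Chat ((m + 1) * p) N
            * (∑ k : I 3 (m + 1) p, r k • Lsq₁ ((m + 1) * p) (e₁ (m + 1) p k)) * Chat ((m + 1) * p) N * Lhat ((m + 1) * p))
            * (∑ k : I 3 (m + 1) p, r' k • Djet ((m + 1) * p) (e₁ (m + 1) p k))ᵀ := by
    rw [sum_smul_Cjet₁ _ N (e₁ (m + 1) p) r, sum_smul_Mjet₁ _ (e₁ (m + 1) p) r', Mjet₀, Matrix.transpose_mul, Matrix.transpose_transpose,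
      Lhat_transpose]
    simp only [Matrix.mul_sub, Matrix.neg_mul, Matrix.mul_neg, Matrix.mul_assoc]
    abel
  rw [e, T7a m p ha hN hNinj hw hw' hδ hr hr' hδB, T7b m p ha hN hNinj hw hδ hr hr' hδB, k7, hat_arr_add_loc _ L1.neg L2,
    TorusBondArrays.hat_arr_neg]

/-- [folklore] **W4 = `M̂₀ᵀ·Ĉ₂·M̂₀` AT PACKED JETS IS `(arr k4)^`**. -/
theorem W4_eq_hat :
    (Mjet₀ ((m + 1) * p))ᵀ
        * (∑ k : I 3 (m + 1) p, ∑ l : I 3 (m + 1) p, (r k * r' l) • Cjet₁₁ ((m + 1) * p) (e₁ (m + 1) p k) (e₁ (m + 1) p l) N)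
        * Mjet₀ ((m + 1) * p)
      = Matrix.of (periodiseF ((m + 1) * p) (toF (arr ((m + 1) * p) (k4 ((m + 1) * p) (m + 1) a w w')))) := by
  have L1 : Loc (dSw (comp (comp (comp lapU (Cgh (m + 1) a)) (l2W ((m + 1) * p) w w')) (comp (Cgh (m + 1) a) lapU))) :=
    uloc_loc (uloc_dSw (m := m) (biLoc_LC_l2W_CL m ha hw hw' hδ hδB) (by linarith)) p
  have L2 : Loc (dSw (comp (comp (comp (comp (comp lapU (Cgh (m + 1) a)) (qW w)) (Cgh (m + 1) a)) (arr ((m + 1) * p) (qW w')))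
      (comp (Cgh (m + 1) a) lapU))) :=
    uloc_loc (uloc_dSw (m := m) (biLoc_LC_qW_Cgh_arr_qW_CL m ha hw hw' hδ hδB) (by linarith)) p
  have L3 : Loc (dSw (comp (comp (comp (comp (comp lapU (Cgh (m + 1) a)) (qW w')) (Cgh (m + 1) a)) (arr ((m + 1) * p) (qW w)))
      (comp (Cgh (m + 1) a) lapU))) :=
    uloc_loc (uloc_dSw (m := m) (biLoc_LC_qW_Cgh_arr_qW_CL m ha hw' hw hδ hδB) (by linarith)) p
  have e : (Mjet₀ ((m + 1) * p))ᵀ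
        * (∑ k : I 3 (m + 1) p, ∑ l : I 3 (m + 1) p, (r k * r' l) • Cjet₁₁ ((m + 1) * p) (e₁ (m + 1) p k) (e₁ (m + 1) p l) N)
        * Mjet₀ ((m + 1) * p)
      = -(Dhat 4 ((m + 1) * p) * (Lhat ((m + 1) * p) * Chat ((m + 1) * p) N
            * (∑ k : I 3 (m + 1) p, ∑ l : I 3 (m + 1) p, (r k * r' l) • Lsq₁₁ ((m + 1) * p) (e₁ (m + 1) p k) (e₁ (m + 1) p l))
            * Chat ((m + 1) * p) N * Lhat ((m + 1) * p)) * (Dhat 4 ((m + 1) * p))ᵀ)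
        + Dhat 4 ((m + 1) * p) * (Lhat ((m + 1) * p) * Chat ((m + 1) * p) N * (∑ k : I 3 (m + 1) p, r k • Lsq₁ ((m + 1) * p) (e₁ (m + 1) p k))
            * Chat ((m + 1) * p) N * (∑ k : I 3 (m + 1) p, r' k • Lsq₁ ((m + 1) * p) (e₁ (m + 1) p k)) * Chat ((m + 1) * p) N * Lhat ((m + 1) * p))
            * (Dhat 4 ((m + 1) * p))ᵀ
        + Dhat 4 ((m + 1) * p) * (Lhat ((m + 1) * p) * Chat ((m + 1) * p) N * (∑ k : I 3 (m + 1) p, r' k • Lsq₁ ((m + 1) * p) (e₁ (m + 1) p k))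
            * Chat ((m + 1) * p) N * (∑ k : I 3 (m + 1) p, r k • Lsq₁ ((m + 1) * p) (e₁ (m + 1) p k)) * Chat ((m + 1) * p) N * Lhat ((m + 1) * p))
            * (Dhat 4 ((m + 1) * p))ᵀ := by
    rw [sum_sum_smul_Cjet₁₁ _ N r r', Mjet₀, Matrix.transpose_mul, Matrix.transpose_transpose, Lhat_transpose]
    simp only [Matrix.mul_add, Matrix.add_mul, Matrix.neg_mul, Matrix.mul_neg, Matrix.mul_assoc]
  rw [e, T4a m p ha hN hNinj hw hw' hδ hr hr' hδB, T4b m p ha hN hNinj hw hw' hδ hr hr' hδB,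
    T4b m p (w := w') (w' := w) ha hN hNinj hw' hw hδ hr' hr hδB, k4, hat_arr_add_loc _ (L1.neg.add L2) L3, hat_arr_add_loc _ L1.neg L2,
    TorusBondArrays.hat_arr_neg]

end Words

/-! ## §2 The transposed words -/

section Transposed
include ha hN hNinj hw hw' hδ hδB hr hr'

/-- [folklore] **W1 = `M̂₂ᵀ·Ĉ·M̂₀ = (W9)ᵀ = (arr (trK k9))^`**. -/
theorem W1_eq_hat :
    (∑ k : I 3 (m + 1) p, ∑ l : I 3 (m + 1) p, (r k * r' l) • Mjet₁₁ ((m + 1) * p) (e₁ (m + 1) p k) (e₁ (m + 1) p l))ᵀ * Chat ((m + 1) * p) N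
        * Mjet₀ ((m + 1) * p)
      = Matrix.of (periodiseF ((m + 1) * p) (toF (arr ((m + 1) * p) (trK (k9 ((m + 1) * p) (m + 1) a w w'))))) := by
  rw [show (∑ k : I 3 (m + 1) p, ∑ l : I 3 (m + 1) p, (r k * r' l) • Mjet₁₁ ((m + 1) * p) (e₁ (m + 1) p k) (e₁ (m + 1) p l))ᵀ
        * Chat ((m + 1) * p) N * Mjet₀ ((m + 1) * p)
      = ((Mjet₀ ((m + 1) * p))ᵀ * Chat ((m + 1) * p) N
          * (∑ k : I 3 (m + 1) p, ∑ l : I 3 (m + 1) p, (r k * r' l) • Mjet₁₁ ((m + 1) * p) (e₁ (m + 1) p k) (e₁ (m + 1) p l)))ᵀ by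
      rw [Matrix.transpose_mul, Matrix.transpose_mul, Matrix.transpose_transpose, transpose_Chat, Matrix.mul_assoc],
    W9_eq_hat m p ha hN hNinj hw hw' hδ hδB hr hr', transpose_hat_arr]

/-- [folklore] **W6 = `−M̂ₜᵀ·Ĉ·M̂ₛ = (W5)ᵀ = (arr (trK k5))^`**. -/
theorem W6_eq_hat :
    -((∑ k : I 3 (m + 1) p, r' k • Mjet₁ ((m + 1) * p) (e₁ (m + 1) p k))ᵀ * Chat ((m + 1) * p) N
        * (∑ k : I 3 (m + 1) p, r k • Mjet₁ ((m + 1) * p) (e₁ (m + 1) p k)))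
      = Matrix.of (periodiseF ((m + 1) * p) (toF (arr ((m + 1) * p) (trK (k5 ((m + 1) * p) (m + 1) a w w'))))) := by
  rw [show -((∑ k : I 3 (m + 1) p, r' k • Mjet₁ ((m + 1) * p) (e₁ (m + 1) p k))ᵀ * Chat ((m + 1) * p) N
        * (∑ k : I 3 (m + 1) p, r k • Mjet₁ ((m + 1) * p) (e₁ (m + 1) p k)))
      = (-((∑ k : I 3 (m + 1) p, r k • Mjet₁ ((m + 1) * p) (e₁ (m + 1) p k))ᵀ * Chat ((m + 1) * p) N
          * (∑ k : I 3 (m + 1) p, r' k • Mjet₁ ((m + 1) * p) (e₁ (m + 1) p k))))ᵀ by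
      rw [Matrix.transpose_neg, Matrix.transpose_mul, Matrix.transpose_mul, Matrix.transpose_transpose, transpose_Chat, Matrix.mul_assoc],
    W5_eq_hat m p ha hN hNinj hw hw' hδ hδB hr hr', transpose_hat_arr]

/-- [folklore] **W3 = `−M̂ₜᵀ·Ĉₛ·M̂₀ = (W7)ᵀ = (arr (trK (k7 w w′)))^`** (`Ĉₛᵀ = −Ĉₛ`). -/
theorem W3_eq_hat :
    -((∑ k : I 3 (m + 1) p, r' k • Mjet₁ ((m + 1) * p) (e₁ (m + 1) p k))ᵀ * (∑ k : I 3 (m + 1) p, r k • Cjet₁ ((m + 1) * p) (e₁ (m + 1) p k) N)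
        * Mjet₀ ((m + 1) * p))
      = Matrix.of (periodiseF ((m + 1) * p) (toF (arr ((m + 1) * p) (trK (k7 ((m + 1) * p) (m + 1) a w w'))))) := by
  rw [show -((∑ k : I 3 (m + 1) p, r' k • Mjet₁ ((m + 1) * p) (e₁ (m + 1) p k))ᵀ * (∑ k : I 3 (m + 1) p, r k • Cjet₁ ((m + 1) * p) (e₁ (m + 1) p k) N)
        * Mjet₀ ((m + 1) * p))
      = ((Mjet₀ ((m + 1) * p))ᵀ * (∑ k : I 3 (m + 1) p, r k • Cjet₁ ((m + 1) * p) (e₁ (m + 1) p k) N)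
          * (∑ k : I 3 (m + 1) p, r' k • Mjet₁ ((m + 1) * p) (e₁ (m + 1) p k)))ᵀ by
      rw [Matrix.transpose_mul, Matrix.transpose_mul, Matrix.transpose_transpose, transpose_sum_smul_Cjet₁]
      simp only [Matrix.neg_mul, Matrix.mul_neg, Matrix.mul_assoc],
    W7_eq_hat m p ha hN hNinj hw hw' hδ hδB hr hr', transpose_hat_arr]

end Transposed

/-! ## §3 The packed twisted mixed weight jet is one array -/

section Assembly
include ha hN hNinj hw hw' hδ hδB hr hr'

/-- [folklore] **`2 • Σ_{kl} (r k·r′ l) • twgtMix s (e₁ k) (e₁ l) N = (arr s (cofPair s (m+1) a w w′))^`** — the twisted mixed co-frame weight jet of TB4-W at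
response-packed bonds, over any basis `N` of `ker Ŝ`, is the bond-fibred periodisation of TA2's array of ONE explicit `s`-uniformly bi-localised `ℤ⁴`
kernel (P2's nine words; W4 W5 W7 W8 W9 by §1, W1 W2 W3 W6 by §2). -/
theorem two_smul_sum_sum_twgtMix_eq_hat :
    (2 : ℝ) • ∑ k : I 3 (m + 1) p, ∑ l : I 3 (m + 1) p, (r k * r' l) • twgtMix ((m + 1) * p) (e₁ (m + 1) p k) (e₁ (m + 1) p l) N
      = Matrix.of (periodiseF ((m + 1) * p) (toF (arr ((m + 1) * p) (cofPair ((m + 1) * p) (m + 1) a w w')))) := by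
  have L9 : Loc (k9 ((m + 1) * p) (m + 1) a w w') := uloc_loc (uloc_k9 m ha hw hw' hδ hδB) p
  have L5 : Loc (k5 ((m + 1) * p) (m + 1) a w w') := uloc_loc (uloc_k5 m ha hw hw' hδ hδB) p
  have L7 : Loc (k7 ((m + 1) * p) (m + 1) a w w') := uloc_loc (uloc_k7 m ha hw hw' hδ hδB) p
  have L8 : Loc (k7 ((m + 1) * p) (m + 1) a w' w) := uloc_loc (uloc_k7 m ha hw' hw hδ hδB) p
  have L4 : Loc (k4 ((m + 1) * p) (m + 1) a w w') := uloc_loc (uloc_k4 m ha hw hw' hδ hδB) p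
  rw [sum_sum_smul_twgtMix _ N r r', W1_eq_hat m p ha hN hNinj hw hw' hδ hδB hr hr',
    W3_eq_hat m p (w := w') (w' := w) ha hN hNinj hw' hw hδ hδB hr' hr, W3_eq_hat m p ha hN hNinj hw hw' hδ hδB hr hr',
    W4_eq_hat m p ha hN hNinj hw hw' hδ hδB hr hr', W5_eq_hat m p ha hN hNinj hw hw' hδ hδB hr hr', W6_eq_hat m p ha hN hNinj hw hw' hδ hδB hr hr',
    W7_eq_hat m p ha hN hNinj hw hw' hδ hδB hr hr', W7_eq_hat m p (w := w') (w' := w) ha hN hNinj hw' hw hδ hδB hr' hr,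
    W9_eq_hat m p ha hN hNinj hw hw' hδ hδB hr hr', cofPair, hat_arr_smul,
    hat_arr_add_loc _ (((((((L9.trK.add L8.trK).add L7.trK).add L4).add L5).add L5.trK).add L7).add L8) L9,
    hat_arr_add_loc _ ((((((L9.trK.add L8.trK).add L7.trK).add L4).add L5).add L5.trK).add L7) L8,
    hat_arr_add_loc _ (((((L9.trK.add L8.trK).add L7.trK).add L4).add L5).add L5.trK) L7,
    hat_arr_add_loc _ ((((L9.trK.add L8.trK).add L7.trK).add L4).add L5) L5.trK,
    hat_arr_add_loc _ (((L9.trK.add L8.trK).add L7.trK).add L4) L5,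
    hat_arr_add_loc _ ((L9.trK.add L8.trK).add L7.trK) L4,
    hat_arr_add_loc _ (L9.trK.add L8.trK) L7.trK, hat_arr_add_loc _ L9.trK L8.trK]

end Assembly

/-! ## §4 At the road's comb basis `N̂` and TB4-W's packed jets: the co-frame half of PART 4's `hJN″` -/

section Road

variable (m : ℕ) {a : ℝ} (p : ℕ) [NeZero p] {r₀ : Fin 4 → ℕ} {w w' : Fin 4 → (Fin 4 → ℤ) → ℝ} {C C' δ : ℝ} {P P' : Fin 4 → ℤ}
  {rS rT : I 3 (m + 1) p → ℝ}

/-- [folklore] **«COFRAME-PACK-2» — THE TWISTED MIXED CO-FRAME WEIGHT JET AT RESPONSE-PACKED TB4-W JETS**: with `N̂ = Nhat r₀ (m+1) p`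
(`r₀ ∈ box 4 (m+1)`), the packed jets `Tₛ = Σ rS•Tjet₁`, `Tₜ`, `Tₛₜ = ΣΣ rS rT•Tjet₁₁`, `A•` likewise (PART 4's pins `hT• hA•`),
`tgramMix T₀ Tₛ Tₜ Tₛₜ A₀ Aₛ Aₜ Aₛₜ = ((toF (arr s (cofPair s (m+1) a w w′)))^).submatrix e₁ e₁`. -/
theorem tgramMix_packed_eq_hat_submatrix (ha : 0 < a) (hr₀ : r₀ ∈ box (3 + 1) (m + 1))
    (hw : ∀ κ u, |w κ u| ≤ C * Real.exp (-δ * l1 (u - P))) (hw' : ∀ κ u, |w' κ u| ≤ C' * Real.exp (-δ * l1 (u - P'))) (hδ : 0 < δ)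
    (hδB : δ ≤ dB (m + 1) a / 8)
    (hrS : ∀ k, rS k = ∑' t : Fin 4 → ℤ, w k.2.2 (imageShift ((m + 1) * p) (windowMap 4 ((m + 1) * p) (torusBlockEquiv (m + 1) p (k.1, k.2.1))) t))
    (hrT : ∀ k, rT k = ∑' t : Fin 4 → ℤ, w' k.2.2 (imageShift ((m + 1) * p) (windowMap 4 ((m + 1) * p) (torusBlockEquiv (m + 1) p (k.1, k.2.1))) t)) :
    tgramMix (Tjet₀ ((m + 1) * p) (Nhat r₀ (m + 1) p) (e₁ (m + 1) p))
        (∑ i : I 3 (m + 1) p, rS i • Tjet₁ ((m + 1) * p) (e₁ (m + 1) p i) (Nhat r₀ (m + 1) p) (e₁ (m + 1) p))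
        (∑ i : I 3 (m + 1) p, rT i • Tjet₁ ((m + 1) * p) (e₁ (m + 1) p i) (Nhat r₀ (m + 1) p) (e₁ (m + 1) p))
        (∑ i : I 3 (m + 1) p, ∑ j : I 3 (m + 1) p, (rS i * rT j) •
          Tjet₁₁ ((m + 1) * p) (e₁ (m + 1) p i) (e₁ (m + 1) p j) (Nhat r₀ (m + 1) p) (e₁ (m + 1) p))
        (Ajet₀ ((m + 1) * p) (Nhat r₀ (m + 1) p))
        (∑ i : I 3 (m + 1) p, rS i • Ajet₁ ((m + 1) * p) (e₁ (m + 1) p i) (Nhat r₀ (m + 1) p))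
        (∑ i : I 3 (m + 1) p, rT i • Ajet₁ ((m + 1) * p) (e₁ (m + 1) p i) (Nhat r₀ (m + 1) p))
        (∑ i : I 3 (m + 1) p, ∑ j : I 3 (m + 1) p, (rS i * rT j) •
          Ajet₁₁ ((m + 1) * p) (e₁ (m + 1) p i) (e₁ (m + 1) p j) (Nhat r₀ (m + 1) p))
      = (Matrix.of (periodiseF ((m + 1) * p) (toF (arr ((m + 1) * p) (cofPair ((m + 1) * p) (m + 1) a w w'))))).submatrix
          (e₁ (m + 1) p) (e₁ (m + 1) p) := by
  rw [tgramMix_packed]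
  simp only [tgramMix_Tjet]
  rw [← submatrix_sum_sum_smul, ← two_smul_sum_sum_twgtMix_eq_hat m p ha (Nhat_range r₀ m p hr₀) (Nhat_injective r₀ (m + 1) p hr₀) hw hw' hδ hδB hrS hrT,
    Finset.smul_sum]
  congr 1
  refine Finset.sum_congr rfl fun i _ => ?_
  rw [Finset.smul_sum]
  exact Finset.sum_congr rfl fun j _ => by rw [smul_comm]

/-- [folklore] **… IN THE SORTED `(I ⊕ J)` CURRENCY OF PART 4's `hJN″`**: `fromBlocks (tgramMix …) 0 0 0 = blocksHat p (sortK (m+1) (arr s (embFF (cofPair s (m+1) a w w′))))`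
(FILE 0 `blocksHat_sortK_arr_embFF`). -/
theorem tgramMix_packed_eq_blocksHat (ha : 0 < a) (hr₀ : r₀ ∈ box (3 + 1) (m + 1))
    (hw : ∀ κ u, |w κ u| ≤ C * Real.exp (-δ * l1 (u - P))) (hw' : ∀ κ u, |w' κ u| ≤ C' * Real.exp (-δ * l1 (u - P'))) (hδ : 0 < δ)
    (hδB : δ ≤ dB (m + 1) a / 8)
    (hrS : ∀ k, rS k = ∑' t : Fin 4 → ℤ, w k.2.2 (imageShift ((m + 1) * p) (windowMap 4 ((m + 1) * p) (torusBlockEquiv (m + 1) p (k.1, k.2.1))) t))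
    (hrT : ∀ k, rT k = ∑' t : Fin 4 → ℤ, w' k.2.2 (imageShift ((m + 1) * p) (windowMap 4 ((m + 1) * p) (torusBlockEquiv (m + 1) p (k.1, k.2.1))) t)) :
    Matrix.fromBlocks
        (tgramMix (Tjet₀ ((m + 1) * p) (Nhat r₀ (m + 1) p) (e₁ (m + 1) p))
          (∑ i : I 3 (m + 1) p, rS i • Tjet₁ ((m + 1) * p) (e₁ (m + 1) p i) (Nhat r₀ (m + 1) p) (e₁ (m + 1) p))
          (∑ i : I 3 (m + 1) p, rT i • Tjet₁ ((m + 1) * p) (e₁ (m + 1) p i) (Nhat r₀ (m + 1) p) (e₁ (m + 1) p))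
          (∑ i : I 3 (m + 1) p, ∑ j : I 3 (m + 1) p, (rS i * rT j) •
            Tjet₁₁ ((m + 1) * p) (e₁ (m + 1) p i) (e₁ (m + 1) p j) (Nhat r₀ (m + 1) p) (e₁ (m + 1) p))
          (Ajet₀ ((m + 1) * p) (Nhat r₀ (m + 1) p))
          (∑ i : I 3 (m + 1) p, rS i • Ajet₁ ((m + 1) * p) (e₁ (m + 1) p i) (Nhat r₀ (m + 1) p))
          (∑ i : I 3 (m + 1) p, rT i • Ajet₁ ((m + 1) * p) (e₁ (m + 1) p i) (Nhat r₀ (m + 1) p))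
          (∑ i : I 3 (m + 1) p, ∑ j : I 3 (m + 1) p, (rS i * rT j) •
            Ajet₁₁ ((m + 1) * p) (e₁ (m + 1) p i) (e₁ (m + 1) p j) (Nhat r₀ (m + 1) p)))
        0 0 (0 : Matrix (J 3 p) (J 3 p) ℝ)
      = blocksHat p (sortK (m + 1) (arr ((m + 1) * p) (embFF (cofPair ((m + 1) * p) (m + 1) a w w')))) := by
  obtain ⟨CN, δN, -, hδN, hN⟩ := PackedCoframePairLoc.biLoc_cofPair_uniform m ha hw hw' hδ hδB
  rw [blocksHat_sortK_arr_embFF (m + 1) p (hN p) hδN, tgramMix_packed_eq_hat_submatrix m p ha hr₀ hw hw' hδ hδB hrS hrT]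

end Road

end Summit.QuantumFields.BalabanUV.Beta.D1BFx.PackedCoframePair

end
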